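import Summits.ValiantsHypothesis.ValiantsHypothesis.Theses.KPlusLogSqLaw
import Summits.ValiantsHypothesis.ValiantsHypothesis.Theorems.LacunarySymmetroidMatrixDescartesCensusFormatMonotone
import Summits.ValiantsHypothesis.ValiantsHypothesis.Theorems.KPlusLogSqLawLiftingFatLocation
import Summits.ValiantsHypothesis.ValiantsHypothesis.Theorems.KPlusLogSqLawTropicalBRegimeCollapse
import Summits.ValiantsHypothesis.ValiantsHypothesis.Theorems.KPlusLogSqLawWeakLiftingBridge

/-!
# Route «KPlusLogSqLaw» — REGIME COLLAPSE on the real side: Conjecture B is a one-parameter statement, and the two THIN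
# stubs of the route (`stub_tropThin`, `stub_liftThin`) already give `Lifting` and `KPlusLogSqLaw`

HONEST FRAMING.  Helper file for the cruxes `TropicalB` (stmt-ValiantsHypothesis-19771) and `Lifting`
(stmt-ValiantsHypothesis-19772) of the DRAFT route `KPlusLogSqLaw` (cell `pub-symmetroid`, seat val-sym-trop-p4 (g2),
2026-08-26).  Every theorem is an IMPLICATION / EQUIVALENCE between statements that are OPEN (the regime stubs of the two
birth skeletons, Conjecture B = `KPlusLogSqLaw`, `Lifting`); nothing is asserted about any of them, about `MatrixDescartes`
(stmt-ValiantsHypothesis-18050) or about VP ≠ VNP.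

Notation (`L = ⌊log₂ m⌋`; all spelled inline, no new `def`; `TropRow ≡ TropRootLawAt` by `Iff.rfl`):
* `TropThin := ∃ C, ∀ m K,   K ≤ L² → TropRootLawAt m K (2^(C·L²))`                             (= `stub_tropThin`),
* `TropFat  := ∃ C, ∀ m K,   L² ≤ K → TropRootLawAt m K (2^(C·K))`                              (= `stub_tropFat`),
* `LiftThin := ∃ C, ∀ m K n, K ≤ L² → TropRootLawAt m K n → RealRootLawAt m K (2^(C·K)·(n+1))`  (= `stub_liftThin`),
* `LiftFat  := ∃ C, ∀ m K n, L² ≤ K → TropRootLawAt m K n → RealRootLawAt m K (2^(C·K)·(n+1))`  (= `stub_liftFat`),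
* `RealThin := ∃ C, ∀ m K,   K ≤ L² → RealRootLawAt m K (2^(C·L²))`,
  `RealFat  := ∃ C, ∀ m K,   L² ≤ K → RealRootLawAt m K (2^(C·K))`  — Conjecture B on the two regimes.

With the LANDED real format monotonicity `Census.realRootLawAt_of_le_terms` / `Census.realRootLawAt_of_le_size`
(file `…CensusFormatMonotone`, seat val-sym-mdr-p1) the regime split of Conjecture B collapses exactly as the tropical one
does (companion file `…TropicalBRegimeCollapse`, whose padding arithmetic is reused):
* `kPlusLogSqLaw_of_realFat` (class padding), `kPlusLogSqLaw_of_realThin` (size padding to `2^(Nat.sqrt K + 1)`),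
  `realThin_iff_kPlusLogSqLaw`, `realFat_iff_kPlusLogSqLaw`; one-parameter forms `kPlusLogSqLaw_iff_logSqRow`
  (the single row `K = ⌊log₂ m⌋²`) and `kPlusLogSqLaw_iff_diagonal` (the formats `(2^s, s²)`).
Consequences for the route's FOUR registered regime stubs:
* `realThin_of_liftThin_of_tropThin` — `LiftThin → TropThin → RealThin` (the thin twin of lift-p2's
  `realFat_of_liftFat_of_tropFat`);
* `kPlusLogSqLaw_of_thinStubs` — **`TropThin → LiftThin → KPlusLogSqLaw`**, and `kPlusLogSqLaw_of_fatStubs` —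
  **`TropFat → LiftFat → KPlusLogSqLaw`**: either regime PAIR alone gives Conjecture B on ALL formats (hence
  `MatrixDescartes` and the summit statement by the tree's `Census.matrixDescartes_of_kPlusLogSqLaw` and the parent
  route's assembly — not restated here);
* `liftFat_of_thinStubs` — `TropThin → LiftThin → LiftFat` (B on fat formats makes the tropical hypothesis of `LiftFat`
  idle, lift-p2's `liftFat_of_realFat`), hence `lifting_of_thinStubs` — **`TropThin → LiftThin → Lifting`**: the fat
  lifting stub is REDUNDANT given the two thin stubs, and (with `tropicalB_of_thinStub` of the companion file) the two THIN
  stubs close BOTH cruxes of the route.  The converse reduction fails where it should: `RealThin → LiftThin` is not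
  available (on thin formats `2^(C·K)·(n+1)` is smaller than B's budget `2^(C·L²)` unless the tropical count `n` is large),
  so `stub_liftThin` is the one stub of the four that is a genuine LIFTING statement;
* route rev 8 (2026-08-26, custody D5) made `WeakLifting` (slack `2^(C(K+L²))`, stmt-ValiantsHypothesis-19561) the load-bearing
  lifting crux and `Lifting` an aside; since `B → WeakLifting` outright (`TropicalCensus.weakLifting_of_kPlusLogSqLaw`, p417903),
  `weakLifting_of_thinStubs` / `weakLifting_of_fatStubs`: either regime pair gives BOTH items `TropicalB` (companion file) and
  `WeakLifting` of the open route.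
[folklore] padding / monotonicity bookkeeping; the statements themselves are conjectures of the cell (no citation exists).
-/

set_option linter.dupNamespace false
set_option autoImplicit false

namespace Summit.ValiantsHypothesis.ValiantsHypothesis.Theorems.KPlusLogSqLaw

open Summit.ValiantsHypothesis.ValiantsHypothesis.Theses.KPlusLogSqLaw (Lifting)
open Summit.ValiantsHypothesis.ValiantsHypothesis.Theorems.LacunarySymmetroidMatrixDescartes (RealRootLawAt KPlusLogSqLaw)
open Summit.ValiantsHypothesis.ValiantsHypothesis.Theorems.LacunarySymmetroidMatrixDescartes.Census
  (realRootLawAt_mono realRootLawAt_of_le_terms realRootLawAt_of_le_size)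
open Summit.ValiantsHypothesis.ValiantsHypothesis.Theorems.LacunarySymmetroidMatrixDescartes.TropicalCensus
  (TropRootLawAt realRootLawAt_zero weakLifting_of_kPlusLogSqLaw)

/-! ## 1. Conjecture B: each regime half alone is the whole law -/

/-- **`RealFat → B` (class padding).**  Conjecture B on fat formats gives `KPlusLogSqLaw` with the same constant: a format
with `K < ⌊log₂ m⌋²` terms is padded with zero coefficient matrices up to `⌊log₂ m⌋²` terms. [folklore] -/
theorem kPlusLogSqLaw_of_realFat
    (h : ∃ C : ℕ, ∀ m K : ℕ, Nat.log 2 m ^ 2 ≤ K → RealRootLawAt m K (2 ^ (C * K))) : KPlusLogSqLaw := by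
  obtain ⟨C, hC⟩ := h
  refine ⟨C, fun m K => ?_⟩
  rcases le_total (Nat.log 2 m ^ 2) K with hK | hK
  · exact realRootLawAt_mono (Nat.pow_le_pow_right two_pos (by nlinarith)) (hC m K hK)
  · have h1 : RealRootLawAt m K (2 ^ (C * Nat.log 2 m ^ 2)) :=
      realRootLawAt_of_le_terms hK (hC m (Nat.log 2 m ^ 2) le_rfl)
    exact realRootLawAt_mono (Nat.pow_le_pow_right two_pos (by nlinarith)) h1

/-- **`RealThin → B` (size padding).**  Conjecture B on thin formats gives `KPlusLogSqLaw` with `4C`: a format with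
`⌊log₂ m⌋² < K` is padded with identity blocks up to size `2^s`, `s = Nat.sqrt K + 1` (`K ≤ s²`, `s² ≤ 3K + 1`). [folklore] -/
theorem kPlusLogSqLaw_of_realThin
    (h : ∃ C : ℕ, ∀ m K : ℕ, K ≤ Nat.log 2 m ^ 2 → RealRootLawAt m K (2 ^ (C * Nat.log 2 m ^ 2))) : KPlusLogSqLaw := by
  obtain ⟨C, hC⟩ := h
  refine ⟨4 * C, fun m K => ?_⟩
  rcases Nat.eq_zero_or_pos K with rfl | hK0
  · exact realRootLawAt_zero m _
  rcases le_total K (Nat.log 2 m ^ 2) with hK | hK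
  · exact realRootLawAt_mono (Nat.pow_le_pow_right two_pos (by nlinarith)) (hC m K hK)
  · have hKs : K ≤ Nat.log 2 (2 ^ (Nat.sqrt K + 1)) ^ 2 := by rw [log_two_pow]; exact le_sqrt_succ_sq K
    have h1 : RealRootLawAt m K (2 ^ (C * Nat.log 2 (2 ^ (Nat.sqrt K + 1)) ^ 2)) :=
      realRootLawAt_of_le_size hK0 (le_two_pow_sqrt_succ hK) (hC _ K hKs)
    rw [log_two_pow] at h1
    have hs : (Nat.sqrt K + 1) ^ 2 ≤ 3 * K + 1 := sqrt_succ_sq_le K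
    exact realRootLawAt_mono (Nat.pow_le_pow_right two_pos (by nlinarith)) h1

/-- `B → RealThin` (`C ↦ 2C`). [folklore] -/
theorem realThin_of_kPlusLogSqLaw (h : KPlusLogSqLaw) :
    ∃ C : ℕ, ∀ m K : ℕ, K ≤ Nat.log 2 m ^ 2 → RealRootLawAt m K (2 ^ (C * Nat.log 2 m ^ 2)) := by
  obtain ⟨C, hC⟩ := h
  refine ⟨2 * C, fun m K hK => realRootLawAt_mono (Nat.pow_le_pow_right two_pos ?_) (hC m K)⟩
  nlinarith

/-- `B → RealFat` (`C ↦ 2C`). [folklore] -/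
theorem realFat_of_kPlusLogSqLaw (h : KPlusLogSqLaw) :
    ∃ C : ℕ, ∀ m K : ℕ, Nat.log 2 m ^ 2 ≤ K → RealRootLawAt m K (2 ^ (C * K)) := by
  obtain ⟨C, hC⟩ := h
  refine ⟨2 * C, fun m K hK => realRootLawAt_mono (Nat.pow_le_pow_right two_pos ?_) (hC m K)⟩
  nlinarith

/-- **`RealThin ↔ B`.** -/
theorem realThin_iff_kPlusLogSqLaw :
    (∃ C : ℕ, ∀ m K : ℕ, K ≤ Nat.log 2 m ^ 2 → RealRootLawAt m K (2 ^ (C * Nat.log 2 m ^ 2))) ↔ KPlusLogSqLaw :=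
  ⟨kPlusLogSqLaw_of_realThin, realThin_of_kPlusLogSqLaw⟩

/-- **`RealFat ↔ B`.** -/
theorem realFat_iff_kPlusLogSqLaw :
    (∃ C : ℕ, ∀ m K : ℕ, Nat.log 2 m ^ 2 ≤ K → RealRootLawAt m K (2 ^ (C * K))) ↔ KPlusLogSqLaw :=
  ⟨kPlusLogSqLaw_of_realFat, realFat_of_kPlusLogSqLaw⟩

/-- **B ↔ the log-square row**: `KPlusLogSqLaw ↔ ∃ C, ∀ m, ζ_tot(m, ⌊log₂ m⌋²) ≤ 2^(C·⌊log₂ m⌋²)`. -/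
theorem kPlusLogSqLaw_iff_logSqRow :
    KPlusLogSqLaw ↔ ∃ C : ℕ, ∀ m : ℕ, RealRootLawAt m (Nat.log 2 m ^ 2) (2 ^ (C * Nat.log 2 m ^ 2)) := by
  constructor
  · rintro ⟨C, hC⟩
    refine ⟨2 * C, fun m => realRootLawAt_mono (Nat.pow_le_pow_right two_pos ?_) (hC m (Nat.log 2 m ^ 2))⟩
    nlinarith
  · rintro ⟨C, hC⟩
    exact kPlusLogSqLaw_of_realThin ⟨C, fun m K hK => realRootLawAt_of_le_terms hK (hC m)⟩

/-- **B ↔ the diagonal**: `KPlusLogSqLaw ↔ ∃ C, ∀ s, ζ_tot(2^s, s²) ≤ 2^(C·s²)` (pad `(m, K)`, `K ≥ 1`, to the diagonal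
format at `s = ⌊log₂ m⌋ + Nat.sqrt K + 1`, where `s² ≤ 6(K + ⌊log₂ m⌋²)`). -/
theorem kPlusLogSqLaw_iff_diagonal :
    KPlusLogSqLaw ↔ ∃ C : ℕ, ∀ s : ℕ, RealRootLawAt (2 ^ s) (s ^ 2) (2 ^ (C * s ^ 2)) := by
  constructor
  · rintro ⟨C, hC⟩
    refine ⟨2 * C, fun s => realRootLawAt_mono (Nat.pow_le_pow_right two_pos ?_) (hC (2 ^ s) (s ^ 2))⟩
    rw [log_two_pow]
    nlinarith
  · rintro ⟨C, hC⟩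
    refine ⟨6 * C, fun m K => ?_⟩
    rcases Nat.eq_zero_or_pos K with rfl | hK0
    · exact realRootLawAt_zero m _
    set L := Nat.log 2 m with hL
    set s := L + Nat.sqrt K + 1 with hs
    have hm : m ≤ 2 ^ s :=
      (Nat.lt_pow_succ_log_self one_lt_two m).le.trans (Nat.pow_le_pow_right two_pos (by omega))
    have hK : K ≤ s ^ 2 := (le_sqrt_succ_sq K).trans (Nat.pow_le_pow_left (by omega) 2)
    have h1 : RealRootLawAt m K (2 ^ (C * s ^ 2)) :=
      realRootLawAt_of_le_size hK0 hm (realRootLawAt_of_le_terms hK (hC s))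
    refine realRootLawAt_mono (Nat.pow_le_pow_right two_pos ?_) h1
    have h2 : Nat.sqrt K ^ 2 ≤ K := Nat.sqrt_le' K
    have h3 : s ^ 2 ≤ 3 * (L ^ 2 + Nat.sqrt K ^ 2 + 1) := by
      rw [hs]; nlinarith [sq_nonneg ((L : ℤ) - Nat.sqrt K), sq_nonneg ((L : ℤ) - 1), sq_nonneg ((Nat.sqrt K : ℤ) - 1)]
    nlinarith

/-! ## 2. The route's four regime stubs: each regime PAIR gives Conjecture B; the thin pair gives `Lifting` -/

/-- **`LiftThin → TropThin → RealThin`** (`C = C_L + C_T + 1`): on thin formats the two thin stubs give Conjecture B's row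
(`2^(C_L·K)·(2^(C_T·L²) + 1) ≤ 2^((C_L + C_T + 1)·L²)` as `K ≤ L²`). [folklore] -/
theorem realThin_of_liftThin_of_tropThin
    (hL : ∃ C : ℕ, ∀ m K n : ℕ, K ≤ Nat.log 2 m ^ 2 → TropRootLawAt m K n → RealRootLawAt m K (2 ^ (C * K) * (n + 1)))
    (hT : ∃ C : ℕ, ∀ m K : ℕ, K ≤ Nat.log 2 m ^ 2 → TropRootLawAt m K (2 ^ (C * Nat.log 2 m ^ 2))) :
    ∃ C : ℕ, ∀ m K : ℕ, K ≤ Nat.log 2 m ^ 2 → RealRootLawAt m K (2 ^ (C * Nat.log 2 m ^ 2)) := by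
  obtain ⟨CL, hL⟩ := hL
  obtain ⟨CT, hT⟩ := hT
  refine ⟨CL + CT + 1, fun m K hK => ?_⟩
  rcases Nat.eq_zero_or_pos K with rfl | hK0
  · exact realRootLawAt_zero m _
  have h1 := hL m K (2 ^ (CT * Nat.log 2 m ^ 2)) hK (hT m K hK)
  refine realRootLawAt_mono ?_ h1
  have e1 : 2 ^ (CT * Nat.log 2 m ^ 2) + 1 ≤ 2 ^ (CT * Nat.log 2 m ^ 2 + 1) :=
    Nat.pow_lt_pow_right (by norm_num) (Nat.lt_succ_self _)
  have e2 : CL * K ≤ CL * Nat.log 2 m ^ 2 := Nat.mul_le_mul_left CL hK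
  calc 2 ^ (CL * K) * (2 ^ (CT * Nat.log 2 m ^ 2) + 1)
      ≤ 2 ^ (CL * K) * 2 ^ (CT * Nat.log 2 m ^ 2 + 1) := Nat.mul_le_mul_left _ e1
    _ = 2 ^ (CL * K + (CT * Nat.log 2 m ^ 2 + 1)) := (pow_add _ _ _).symm
    _ ≤ 2 ^ ((CL + CT + 1) * Nat.log 2 m ^ 2) := Nat.pow_le_pow_right (by norm_num) (by nlinarith)

/-- **The two THIN stubs give Conjecture B**: `TropThin → LiftThin → KPlusLogSqLaw`. -/
theorem kPlusLogSqLaw_of_thinStubs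
    (hT : ∃ C : ℕ, ∀ m K : ℕ, K ≤ Nat.log 2 m ^ 2 → TropRootLawAt m K (2 ^ (C * Nat.log 2 m ^ 2)))
    (hL : ∃ C : ℕ, ∀ m K n : ℕ, K ≤ Nat.log 2 m ^ 2 → TropRootLawAt m K n → RealRootLawAt m K (2 ^ (C * K) * (n + 1))) :
    KPlusLogSqLaw :=
  kPlusLogSqLaw_of_realThin (realThin_of_liftThin_of_tropThin hL hT)

/-- **The two FAT stubs give Conjecture B**: `TropFat → LiftFat → KPlusLogSqLaw` (lift-p2's `realFat_of_liftFat_of_tropFat`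
followed by class padding). -/
theorem kPlusLogSqLaw_of_fatStubs
    (hT : ∃ C : ℕ, ∀ m K : ℕ, Nat.log 2 m ^ 2 ≤ K → TropRootLawAt m K (2 ^ (C * K)))
    (hL : ∃ C : ℕ, ∀ m K n : ℕ, Nat.log 2 m ^ 2 ≤ K → TropRootLawAt m K n → RealRootLawAt m K (2 ^ (C * K) * (n + 1))) :
    KPlusLogSqLaw :=
  kPlusLogSqLaw_of_realFat (realFat_of_liftFat_of_tropFat hL hT)

/-- **The thin pair gives the fat lifting stub**: `TropThin → LiftThin → LiftFat` (B holds, so on fat formats the tropical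
hypothesis of `LiftFat` is idle). -/
theorem liftFat_of_thinStubs
    (hT : ∃ C : ℕ, ∀ m K : ℕ, K ≤ Nat.log 2 m ^ 2 → TropRootLawAt m K (2 ^ (C * Nat.log 2 m ^ 2)))
    (hL : ∃ C : ℕ, ∀ m K n : ℕ, K ≤ Nat.log 2 m ^ 2 → TropRootLawAt m K n → RealRootLawAt m K (2 ^ (C * K) * (n + 1))) :
    ∃ C : ℕ, ∀ m K n : ℕ, Nat.log 2 m ^ 2 ≤ K → TropRootLawAt m K n → RealRootLawAt m K (2 ^ (C * K) * (n + 1)) :=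
  liftFat_of_realFat (realFat_of_kPlusLogSqLaw (kPlusLogSqLaw_of_thinStubs hT hL))

/-- **The thin pair gives `Lifting`**: `TropThin → LiftThin → Lifting` (glue the thin stub with the derived fat one,
`C = C₁ + C₂`). -/
theorem lifting_of_thinStubs
    (hT : ∃ C : ℕ, ∀ m K : ℕ, K ≤ Nat.log 2 m ^ 2 → TropRootLawAt m K (2 ^ (C * Nat.log 2 m ^ 2)))
    (hL : ∃ C : ℕ, ∀ m K n : ℕ, K ≤ Nat.log 2 m ^ 2 → TropRootLawAt m K n → RealRootLawAt m K (2 ^ (C * K) * (n + 1))) :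
    Lifting := by
  obtain ⟨C₂, h₂⟩ := liftFat_of_thinStubs hT hL
  obtain ⟨C₁, h₁⟩ := hL
  refine ⟨C₁ + C₂, fun m K n hrow => ?_⟩
  show RealRootLawAt m K (2 ^ ((C₁ + C₂) * K) * (n + 1))
  rcases le_total K (Nat.log 2 m ^ 2) with hK | hK
  · refine realRootLawAt_mono (Nat.mul_le_mul_right _ (Nat.pow_le_pow_right two_pos ?_)) (h₁ m K n hK hrow)
    nlinarith
  · refine realRootLawAt_mono (Nat.mul_le_mul_right _ (Nat.pow_le_pow_right two_pos ?_)) (h₂ m K n hK hrow)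
    nlinarith

/-! ## 3. Route rev 8: the load-bearing lifting crux `WeakLifting` from either regime pair

`WeakLifting` is stated here in its tree-row form `∃ C, ∀ m K n, TropRootLawAt m K n → RealRootLawAt m K (2^(C(K+L²))·(n+1))`
(δ-equal to `Theses.KPlusLogSqLaw.WeakLifting`, exactly as in `…WeakLiftingBridge`). -/

/-- **The thin pair gives `WeakLifting`**: `TropThin → LiftThin → WeakLifting` (through Conjecture B, which makes the
tropical hypothesis of `WeakLifting` idle). -/
theorem weakLifting_of_thinStubs
    (hT : ∃ C : ℕ, ∀ m K : ℕ, K ≤ Nat.log 2 m ^ 2 → TropRootLawAt m K (2 ^ (C * Nat.log 2 m ^ 2)))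
    (hL : ∃ C : ℕ, ∀ m K n : ℕ, K ≤ Nat.log 2 m ^ 2 → TropRootLawAt m K n → RealRootLawAt m K (2 ^ (C * K) * (n + 1))) :
    ∃ C : ℕ, ∀ m K n : ℕ, TropRootLawAt m K n → RealRootLawAt m K (2 ^ (C * (K + Nat.log 2 m ^ 2)) * (n + 1)) :=
  weakLifting_of_kPlusLogSqLaw (kPlusLogSqLaw_of_thinStubs hT hL)

/-- **The fat pair gives `WeakLifting`**: `TropFat → LiftFat → WeakLifting`. -/
theorem weakLifting_of_fatStubs
    (hT : ∃ C : ℕ, ∀ m K : ℕ, Nat.log 2 m ^ 2 ≤ K → TropRootLawAt m K (2 ^ (C * K)))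
    (hL : ∃ C : ℕ, ∀ m K n : ℕ, Nat.log 2 m ^ 2 ≤ K → TropRootLawAt m K n → RealRootLawAt m K (2 ^ (C * K) * (n + 1))) :
    ∃ C : ℕ, ∀ m K n : ℕ, TropRootLawAt m K n → RealRootLawAt m K (2 ^ (C * (K + Nat.log 2 m ^ 2)) * (n + 1)) :=
  weakLifting_of_kPlusLogSqLaw (kPlusLogSqLaw_of_fatStubs hT hL)

end Summit.ValiantsHypothesis.ValiantsHypothesis.Theorems.KPlusLogSqLaw
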